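import Mathlib

/-!
# Single-orbit constructors certify rank at most one over the fixed field

Solo-informed kernel file 16 (session s10, census row R44).

## The algebra (what is proved here, sorry-free)

Let `G` be a finite group acting `ℚ`-linearly on `V` (a `Representation ℚ G V`), let
`χ : G →* ℚˣ` be a character and `w : V`.  Every `χ`-eigenvector of `G` lying in the
`ℚ`-span of the orbit `{ρ g w}` is a rational multiple of the twisted trace
`∑ g, χ(g)⁻¹ • ρ g w`; hence the `χ`-eigenspace of the cyclic module `ℚ[G]·w` has
`finrank ≤ 1`.  Equivalently: if `Q : ι → V` is a `G`-equivariant family indexed by a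
TRANSITIVE `G`-set `ι` ("directions"), then however large `ι` is, the `G`-invariant part of
`span (range Q)` is at most a line (the line of the trace).

## The dictionary (interpretation, NOT formalised; recorded for the repair census)

Rank-two BSD over `ℚ` needs a constructor of two independent rational points.  Every analytic
point constructor in print is *single-orbit* in the above sense, with `V = A(F̄) ⊗ ℚ`:
* Heegner points of a fixed conductor form one `Gal(H_c/ℚ)`-orbit, so each `ℚ`-isotypic
  component receives rank `≤ 1` (the trace) — Gross–Zagier/Kolyvagin folklore (census E31).
* Archimedean plectic points (M. Fornea, *Plectic Jacobians*, Quart. J. Math. 2024,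
  doi:10.1093/qmath/haae025 = arXiv:2305.01130, Def. 6.7, Conj. 6.8, Conj. 6.10): for a modular
  elliptic curve `A/F`, `F` totally real, the `r` points `w_{ψ,1},…,w_{ψ,r}` are indexed by the
  set `Σ` of split archimedean places, one exotic Abel–Jacobi map `AJ^j_pl` per direction
  (Thm. 2), and Conj. 6.10 predicts they generate `A^E(F)` when `r_alg(A^E/F)=r`.  If the whole
  datum descends to `ℚ` (curve `A = E₀ ×_ℚ F`, `B = B₀ ⊗_ℚ F`, Galois-stable Eichler order, CM
  field `E = F·K`, `h(E) = 1`), then `G = Gal(F/ℚ)` acts transitively on `Σ = Hom(F,ℝ)` and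
  transport of structure along the holomorphic swap of `X_B` gives, EXACTLY,
  `Q_{ψ^σ,σj}(σ_B γ_j) = ± Q_{ψ,j}(γ_j)`, where `γ_j ∈ R^×` is the auxiliary unit defining the
  involution `Fr_j` (loc. cit. p. 12: "an element such that …", fixed once) and `ψ^σ` the
  transported embedding.  The plectic point depends on `(ψ, γ_j)` through its plectic
  zero-cycle (Def. 6.6), two of whose four vertices depend on `γ_j`; hence the equivariance
  hypothesis `hQ` below holds for `Q(j) = w_{ψ,j}` (modulo torsion and sign) IF AND ONLY IF
  the recipe is LIFT-INDEPENDENT: `Q_{ψ,j}(γ)` constant modulo torsion in the admissible `γ`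
  (hypothesis `(H_γ)` of the census; the source neither states nor excludes it).  Under `(H_γ)`
  the `Gal(F/ℚ)`-invariant part `E₀^K(ℚ) ⊗ ℚ` of the span has rank `≤ 1`, so no rank-two
  constructor for a curve over `ℚ` is obtained by real-quadratic base change, and Conj. 6.10's
  generation clause needs the proviso "not a base change"; without `(H_γ)` Definition 6.7 is a
  lift-dependent recipe (its cycles then differ by zero-cycles on non-special points) and the
  lemma does not apply to it.  This is the archimedean counterpart of the `p`-adic
  degeneracies recorded in `Literature.Barriers.BirchSwinnertonDyer.PlecticDeterminantOverQ`
  (Fornea–Gehrmann, arXiv:2104.12575, Rem. 1.1) and in Darmon–Fornea, *Mock plectic points*,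
  JIMJ 2025 (arXiv:2310.16758), Remark 5 ("can vanish for trivial reasons, for example when
  `E(ℚ)` has rank two").  (An earlier version of this docstring asserted the equivariance
  unconditionally; corrected 2026-08-18 after a numerical control exposed the dependence on
  `γ_j`.)
Consequence for the sharpest statement: a rank-two constructor over `ℚ` must be TWO-orbit
(two non-conjugate inputs with independently certified outputs) or non-equivariant — and a
non-equivariant one pays with non-canonical auxiliary choices.
-/

namespace Summit.BirchSwinnertonDyer.BirchSwinnertonDyer.Theorems

open scoped BigOperators

section SingleOrbit

variable {G V : Type*} [Group G] [Fintype G] [AddCommGroup V] [Module ℚ V]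

/-- The `χ`-twisted trace `∑_g χ(g)⁻¹ • ρ(g) w` of `w`. -/
noncomputable def twistedTrace (ρ : Representation ℚ G V) (χ : G →* ℚˣ) (w : V) : V :=
  ∑ g : G, (((χ g)⁻¹ : ℚˣ) : ℚ) • ρ g w

/-- The `χ`-twisted averaging operator `T = ∑_h χ(h)⁻¹ • ρ(h)` as a linear map. -/
noncomputable def twistedSum (ρ : Representation ℚ G V) (χ : G →* ℚˣ) : V →ₗ[ℚ] V :=
  ∑ h : G, (((χ h)⁻¹ : ℚˣ) : ℚ) • ρ h

/-- Pointwise formula for the twisted averaging operator. -/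
lemma twistedSum_apply (ρ : Representation ℚ G V) (χ : G →* ℚˣ) (v : V) :
    twistedSum ρ χ v = ∑ h : G, (((χ h)⁻¹ : ℚˣ) : ℚ) • ρ h v := by
  simp [twistedSum, LinearMap.sum_apply, LinearMap.smul_apply]

/-- The `χ`-eigenspace of `G` in `V`: vectors with `ρ g v = χ g • v` for all `g`. -/
def eigenSubmodule (ρ : Representation ℚ G V) (χ : G →* ℚˣ) : Submodule ℚ V :=
  ⨅ g : G, LinearMap.ker (ρ g - ((χ g : ℚˣ) : ℚ) • LinearMap.id)

omit [Fintype G] in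
/-- Membership in the `χ`-eigenspace, unfolded. -/
lemma mem_eigenSubmodule {ρ : Representation ℚ G V} {χ : G →* ℚˣ} {v : V} :
    v ∈ eigenSubmodule ρ χ ↔ ∀ g : G, ρ g v = ((χ g : ℚˣ) : ℚ) • v := by
  simp [eigenSubmodule, Submodule.mem_iInf, LinearMap.mem_ker, sub_eq_zero]

/-- On a `χ`-eigenvector the twisted averaging operator is multiplication by `|G|`. -/
lemma twistedSum_apply_of_eigen (ρ : Representation ℚ G V) (χ : G →* ℚˣ) {v : V}
    (hv : ∀ g : G, ρ g v = ((χ g : ℚˣ) : ℚ) • v) :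
    twistedSum ρ χ v = (Fintype.card G : ℚ) • v := by
  rw [twistedSum_apply]
  have : ∀ h : G, (((χ h)⁻¹ : ℚˣ) : ℚ) • ρ h v = v := by
    intro h
    rw [hv h, smul_smul, Units.inv_mul, one_smul]
  simp_rw [this, Finset.sum_const, Finset.card_univ, ← Nat.cast_smul_eq_nsmul ℚ]

/-- The twisted averaging operator sends every orbit element into the line of the twisted
trace: `T (ρ g w) = χ g • twistedTrace ρ χ w`. -/
lemma twistedSum_apply_orbit (ρ : Representation ℚ G V) (χ : G →* ℚˣ) (w : V) (g : G) :
    twistedSum ρ χ (ρ g w) = ((χ g : ℚˣ) : ℚ) • twistedTrace ρ χ w := by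
  rw [twistedSum_apply, twistedTrace, Finset.smul_sum]
  -- reindex `h ↦ h * g`
  have key : ∀ h : G, (((χ h)⁻¹ : ℚˣ) : ℚ) • ρ h (ρ g w)
      = (fun h' : G => (((χ (h' * g⁻¹))⁻¹ : ℚˣ) : ℚ) • ρ h' w) (h * g) := by
    intro h
    simp only [mul_inv_cancel_right, map_mul]
    rfl
  rw [Fintype.sum_equiv (Equiv.mulRight g) _
      (fun h' : G => (((χ (h' * g⁻¹))⁻¹ : ℚˣ) : ℚ) • ρ h' w) (fun h => key h)]
  refine Finset.sum_congr rfl (fun h' _ => ?_)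
  rw [map_mul, map_inv, mul_inv, inv_inv, mul_comm, Units.val_mul, mul_smul]

/-- The span of the orbit of `w` is mapped by the twisted averaging operator into the line
spanned by the twisted trace. -/
lemma twistedSum_mem_span_twistedTrace (ρ : Representation ℚ G V) (χ : G →* ℚˣ) (w : V)
    {v : V} (hv : v ∈ Submodule.span ℚ (Set.range fun g : G => ρ g w)) :
    twistedSum ρ χ v ∈ (ℚ ∙ twistedTrace ρ χ w) := by
  have hle : Submodule.span ℚ (Set.range fun g : G => ρ g w)
      ≤ (ℚ ∙ twistedTrace ρ χ w).comap (twistedSum ρ χ) := by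
    rw [Submodule.span_le]
    rintro _ ⟨g, rfl⟩
    simp only [SetLike.mem_coe, Submodule.mem_comap]
    rw [twistedSum_apply_orbit]
    exact Submodule.smul_mem _ _ (Submodule.mem_span_singleton_self _)
  exact hle hv

/-- **Single-orbit lemma.**  A `χ`-eigenvector of `G` lying in the span of one `G`-orbit is a
rational multiple of the twisted trace of that orbit. -/
theorem mem_span_twistedTrace_of_mem_span_orbit (ρ : Representation ℚ G V) (χ : G →* ℚˣ)
    (w : V) {v : V} (hv : v ∈ Submodule.span ℚ (Set.range fun g : G => ρ g w))
    (heig : ∀ g : G, ρ g v = ((χ g : ℚˣ) : ℚ) • v) :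
    v ∈ (ℚ ∙ twistedTrace ρ χ w) := by
  have hT := twistedSum_mem_span_twistedTrace ρ χ w hv
  rw [twistedSum_apply_of_eigen ρ χ heig] at hT
  have hcard : (Fintype.card G : ℚ) ≠ 0 := by
    exact_mod_cast Fintype.card_ne_zero
  have : v = (Fintype.card G : ℚ)⁻¹ • ((Fintype.card G : ℚ) • v) := by
    rw [smul_smul, inv_mul_cancel₀ hcard, one_smul]
  rw [this]
  exact Submodule.smul_mem _ _ hT

/-- Existential form: the eigenvector is `c •` the twisted trace for some `c : ℚ`. -/
theorem exists_eq_smul_twistedTrace (ρ : Representation ℚ G V) (χ : G →* ℚˣ)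
    (w : V) {v : V} (hv : v ∈ Submodule.span ℚ (Set.range fun g : G => ρ g w))
    (heig : ∀ g : G, ρ g v = ((χ g : ℚˣ) : ℚ) • v) :
    ∃ c : ℚ, c • twistedTrace ρ χ w = v :=
  Submodule.mem_span_singleton.mp (mem_span_twistedTrace_of_mem_span_orbit ρ χ w hv heig)

/-- The `χ`-eigenspace of the cyclic module generated by `w` sits inside the line of the
twisted trace. -/
theorem span_orbit_inf_eigenSubmodule_le (ρ : Representation ℚ G V) (χ : G →* ℚˣ) (w : V) :
    Submodule.span ℚ (Set.range fun g : G => ρ g w) ⊓ eigenSubmodule ρ χ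
      ≤ (ℚ ∙ twistedTrace ρ χ w) := by
  intro v hv
  rcases hv with ⟨hspan, heig⟩
  exact mem_span_twistedTrace_of_mem_span_orbit ρ χ w hspan (mem_eigenSubmodule.mp heig)

/-- **Rank form.**  The `χ`-eigenspace of a cyclic `ℚ[G]`-module has dimension at most one. -/
theorem finrank_span_orbit_inf_eigenSubmodule_le_one [FiniteDimensional ℚ V]
    (ρ : Representation ℚ G V) (χ : G →* ℚˣ) (w : V) :
    Module.finrank ℚ
      ↥(Submodule.span ℚ (Set.range fun g : G => ρ g w) ⊓ eigenSubmodule ρ χ) ≤ 1 := by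
  refine (Submodule.finrank_mono (span_orbit_inf_eigenSubmodule_le ρ χ w)).trans ?_
  simpa using finrank_span_le_card ({twistedTrace ρ χ w} : Set V)

/-- Invariant (`χ = 1`) special case: a `G`-fixed vector in the span of one orbit is a multiple
of the plain trace `∑ g, ρ g w`. -/
theorem exists_eq_smul_trace_of_invariant (ρ : Representation ℚ G V) (w : V) {v : V}
    (hv : v ∈ Submodule.span ℚ (Set.range fun g : G => ρ g w))
    (hfix : ∀ g : G, ρ g v = v) :
    ∃ c : ℚ, c • (∑ g : G, ρ g w) = v := by
  obtain ⟨c, hc⟩ := exists_eq_smul_twistedTrace ρ 1 w hv (by simpa using hfix)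
  refine ⟨c, ?_⟩
  simpa [twistedTrace] using hc

end SingleOrbit

section EquivariantConstructor

variable {G V ι : Type*} [Group G] [Fintype G] [AddCommGroup V] [Module ℚ V]
  [MulAction G ι]

omit [Fintype G] in
/-- An equivariant family on a transitive `G`-set is one orbit: its range is the orbit of any
of its values. -/
lemma range_eq_range_orbit_of_equivariant (ρ : Representation ℚ G V) (Q : ι → V)
    (hQ : ∀ (g : G) (i : ι), Q (g • i) = ρ g (Q i))
    (htrans : ∀ i j : ι, ∃ g : G, g • i = j) (i₀ : ι) :
    Set.range Q = Set.range fun g : G => ρ g (Q i₀) := by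
  ext v
  constructor
  · rintro ⟨j, rfl⟩
    obtain ⟨g, rfl⟩ := htrans i₀ j
    exact ⟨g, (hQ g i₀).symm⟩
  · rintro ⟨g, rfl⟩
    exact ⟨g • i₀, hQ g i₀⟩

/-- **Equivariant single-orbit constructors give rank ≤ 1 in every `ℚ`-isotypic line.**
If `Q : ι → V` is `G`-equivariant on a transitive `G`-set of "directions" `ι`, then every
`χ`-eigenvector in `span (range Q)` is a multiple of one twisted trace — independently of the
number of directions. -/
theorem exists_eq_smul_twistedTrace_of_equivariant (ρ : Representation ℚ G V) (χ : G →* ℚˣ)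
    (Q : ι → V) (hQ : ∀ (g : G) (i : ι), Q (g • i) = ρ g (Q i))
    (htrans : ∀ i j : ι, ∃ g : G, g • i = j) (i₀ : ι) {v : V}
    (hv : v ∈ Submodule.span ℚ (Set.range Q))
    (heig : ∀ g : G, ρ g v = ((χ g : ℚˣ) : ℚ) • v) :
    ∃ c : ℚ, c • twistedTrace ρ χ (Q i₀) = v := by
  rw [range_eq_range_orbit_of_equivariant ρ Q hQ htrans i₀] at hv
  exact exists_eq_smul_twistedTrace ρ χ (Q i₀) hv heig

/-- Rank form of the previous theorem: the `G`-invariant part (more generally any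
`χ`-eigenspace) of the span of an equivariant family on a transitive `G`-set has
`finrank ≤ 1`. -/
theorem finrank_span_range_inf_eigenSubmodule_le_one [FiniteDimensional ℚ V]
    (ρ : Representation ℚ G V) (χ : G →* ℚˣ)
    (Q : ι → V) (hQ : ∀ (g : G) (i : ι), Q (g • i) = ρ g (Q i))
    (htrans : ∀ i j : ι, ∃ g : G, g • i = j) (i₀ : ι) :
    Module.finrank ℚ ↥(Submodule.span ℚ (Set.range Q) ⊓ eigenSubmodule ρ χ) ≤ 1 := by
  rw [range_eq_range_orbit_of_equivariant ρ Q hQ htrans i₀]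
  exact finrank_span_orbit_inf_eigenSubmodule_le_one ρ χ (Q i₀)

/-- **No two independent invariant points from one orbit.**  Under the same hypotheses there
are no two `ℚ`-linearly independent `G`-fixed vectors in `span (range Q)`; in the BSD
dictionary: an equivariant direction-indexed point constructor never certifies
Mordell–Weil rank `≥ 2` over the fixed field by the span of its outputs. -/
theorem not_linearIndependent_pair_of_equivariant [FiniteDimensional ℚ V]
    (ρ : Representation ℚ G V)
    (Q : ι → V) (hQ : ∀ (g : G) (i : ι), Q (g • i) = ρ g (Q i))
    (htrans : ∀ i j : ι, ∃ g : G, g • i = j) (i₀ : ι)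
    {v₁ v₂ : V} (h₁ : v₁ ∈ Submodule.span ℚ (Set.range Q))
    (h₂ : v₂ ∈ Submodule.span ℚ (Set.range Q))
    (hfix₁ : ∀ g : G, ρ g v₁ = v₁) (hfix₂ : ∀ g : G, ρ g v₂ = v₂) :
    ¬ LinearIndependent ℚ ![v₁, v₂] := by
  intro hli
  set W : Submodule ℚ V := Submodule.span ℚ (Set.range Q) ⊓ eigenSubmodule ρ 1 with hW
  have hm₁ : v₁ ∈ W := ⟨h₁, mem_eigenSubmodule.mpr (by simpa using hfix₁)⟩
  have hm₂ : v₂ ∈ W := ⟨h₂, mem_eigenSubmodule.mpr (by simpa using hfix₂)⟩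
  have hrk : Module.finrank ℚ ↥W ≤ 1 :=
    finrank_span_range_inf_eigenSubmodule_le_one ρ 1 Q hQ htrans i₀
  -- restrict the independent pair to `W`
  let f : Fin 2 → ↥W := ![⟨v₁, hm₁⟩, ⟨v₂, hm₂⟩]
  have hf : LinearIndependent ℚ f := by
    have hcomp : (W.subtype : ↥W →ₗ[ℚ] V) ∘ f = ![v₁, v₂] := by
      ext i
      fin_cases i <;> rfl
    have : LinearIndependent ℚ ((W.subtype : ↥W →ₗ[ℚ] V) ∘ f) := by
      rw [hcomp]; exact hli
    exact LinearIndependent.of_comp _ this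
  have h2 : (2 : ℕ) ≤ Module.finrank ℚ ↥W := by
    simpa using hf.fintype_card_le_finrank
  omega

end EquivariantConstructor

end Summit.BirchSwinnertonDyer.BirchSwinnertonDyer.Theorems
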